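import Summits.KontsevichZagierPeriods.KontsevichZagierPeriods.Theorems.PlanarAreas.Negative.HorizontalMove
import Summits.KontsevichZagierPeriods.KontsevichZagierPeriods.Theorems.PlanarAreas.Negative.Tightness
import Summits.KontsevichZagierPeriods.KontsevichZagierPeriods.Theorems.StuffleInKZ.Negative.AlgebraicShadow

/-!
# `PlanarAreas` (stmt-KontsevichZagierPeriods-4990): negative side — X. the fibred sub-calculus and the marginal shadow versus the window invariant

Negative-side support for the crux `PlanarAreas` (cdisprove cycle 2; work file
`Cruxes/PlanarAreas/Disproof.lean` §7e–§7f).  Two bridges from Negative/HorizontalMove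
(`not_withoutHorizontalMove`: rules 1a/1b/3 plus first-coordinate-FIXING changes of variables do not
connect the hyperbola region `R = {1<x<2, 0<y<1/x}` to `R + (3,0)`) to the vocabulary of the tree
and of the cdisprove unit of `StuffleInKZ` (stmt-3931):

* §1 FIBRED SUB-CALCULUS (`Literature/…/KZFibredRelations.lean`): `KZ.fibredChangeOfVariablesRel`
  ("`Φ x 0 = x 0`") is contained in `fixingFirstCoordCoVRel` and `KZ.fibredNewtonLeibnizRel ⊆ NL`,
  so `closure (KZ.fibredGenerators ∪ KZ.newtonLeibnizRel)` — the sub-calculus of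
  `StuffleInKZ.Negative.swapWitness_not_mem_closure_fibred_nl` (Theorems/StuffleInKZ/Negative/
  ChangeOfVariablesFree.lean) — lies inside the sub-calculus of `not_withoutHorizontalMove`; hence
  `hyp_not_mem_closure_fibred_nl` and `not_fibredNLTransitiveOnAreas`: the fibred + Newton–Leibniz
  sub-calculus is not transitive on equal-AREA integrand-`1` planar pairs either (the StuffleInKZ
  witness `[(0,1)×(1,2), dz/(z₀+z₁)]` has a non-constant integrand), while `R + (0,5)` IS
  `KZ.FibredEquivalent` to `R` (`fibredEquivalent_hypRep_hypUpRep`).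
* §2 MARGINAL SHADOW (`StuffleInKZ.Negative.algShadow = {c | sliceEval c is a.e. ℚ-semialgebraic}`,
  the invariant behind the StuffleInKZ separation): it is BLIND on the pair — `R` is congruent
  modulo `covFreeRelations = closure (1a ∪ 1b ∪ 3)` to its dimension-`1` Newton–Leibniz shadow
  `[(1,2), 1/x]` (null arcs inside `closure domainAddRel` + one NL move), which has an algebraic
  shadow, so `HasAlgShadow [R]`, `HasAlgShadow [R + (3,0)]`, `HasAlgShadow ([R] − [R + (3,0)])`
  (`hasAlgShadow_hyp_pair`).  On integrand-`1` planar regions the marginal is the fibre LENGTH, a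
  semialgebraic function, so this blindness is the general situation on the scope of the crux; the
  window invariant reads the PRIMITIVE of the marginal (`log e`), where the transcendence sits:
  `shadow_blind_window_sees`.

Everything is sorry-free; axioms ⊆ {propext, Classical.choice, Quot.sound}.

Sources: M. Kontsevich, D. Zagier, *Periods* (2001), §1.2; J. Ayoub, *Une version relative de la
conjecture des périodes de Kontsevich–Zagier*, Ann. of Math. 181 (2015), §1 (moves relative to a
base); J. Fresán (2024), Rem. 3.6. -/

noncomputable section

open Set MeasureTheory MvPolynomial Filter Topology
open Literature.NumberTheory.Transcendental Literature.ModelTheory.ExponentialFields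
open Summit.KontsevichZagierPeriods.Theorems.StuffleInKZ.Negative
  (HasAlgShadow algShadow mem_algShadow covFreeRelations covFreeRelations_le_algShadow
    hasAlgShadow_of_dim_one newtonLeibnizRel_subset_covFreeRelations)

namespace Summit.KontsevichZagierPeriods.PlanarAreas.Negative


/-! ## §1 Bridge to the tree's FIBRED sub-calculus (`KZFibredRelations`, StuffleInKZ/Negative)

The tree's `KZ.fibredChangeOfVariablesRel` ("`Φ x 0 = x 0`", dimensions `n + 1`) is contained in
`fixingFirstCoordCoVRel`, and `KZ.fibredGenerators = 1a ∪ 1b ∪ fibredCoV ∪ fibredNL` with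
`fibredNL ⊆ NL`; so the sub-calculus `closure (KZ.fibredGenerators ∪ KZ.newtonLeibnizRel)` of
`StuffleInKZ.Negative.swapWitness_not_mem_closure_fibred_nl` (Theorems/StuffleInKZ/Negative/
ChangeOfVariablesFree.lean: the swap of `[(0,1)×(1,2), dz/(z₀+z₁)]` is not generated by fibred and
Newton–Leibniz moves, via the MARGINAL-SHADOW invariant `algShadow`) is contained in the §7
sub-calculus.  COMPLEMENTARITY: on integrand-`1` planar regions the marginal shadow is ALWAYS
algebraic (fibre lengths of a semialgebraic set form a semialgebraic function; for `R` it is `1/s` on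
`(1,2)`), so `algShadow` is blind on the whole scope of the crux; the window invariant sees the
PRIMITIVE of the marginal (`log`), which is where the transcendence sits.  Hence the new fact below:
the fibred + Newton–Leibniz sub-calculus is not transitive on equal-area integrand-`1` planar pairs
either (`hyp_not_mem_closure_fibred_nl`, `not_fibredNL_transitive_on_areas`). -/

/-- The tree's fibred changes of variables fix the first coordinate. [cite: KontsevichZagier2001, §1.2 rule (2)] -/
theorem fibredChangeOfVariablesRel_subset_fixing :
    KZ.fibredChangeOfVariablesRel ⊆ fixingFirstCoordCoVRel := by
  rintro c ⟨n, r, r', Φ, Φ', hΦ, hd, hinj, hdom, hf, hfix, rfl⟩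
  refine ⟨n + 1, r, r', Φ, Φ', hΦ, hd, hinj, hdom, hf, ?_, rfl⟩
  intro x hx i hi
  have : i = 0 := Fin.ext hi
  subst this
  exact hfix x hx

/-- `closure (fibredGenerators ∪ newtonLeibnizRel) ≤ closure (1a ∪ 1b ∪ fixing ∪ NL)`. [cite: KontsevichZagier2001, §1.2] -/
theorem closure_fibred_nl_le_closure_fixing :
    AddSubgroup.closure (KZ.fibredGenerators ∪ KZ.newtonLeibnizRel) ≤
      AddSubgroup.closure (KZ.domainAddRel ∪ KZ.integrandAddRel ∪ fixingFirstCoordCoVRel ∪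
        KZ.newtonLeibnizRel) := by
  refine AddSubgroup.closure_mono ?_
  rintro c (hc | hc)
  · rcases (KZ.mem_fibredGenerators_iff.mp hc) with h | h | h | h
    · exact Or.inl (Or.inl (Or.inl h))
    · exact Or.inl (Or.inl (Or.inr h))
    · exact Or.inl (Or.inr (fibredChangeOfVariablesRel_subset_fixing h))
    · exact Or.inr (KZ.fibredNewtonLeibnizRel_subset_newtonLeibnizRel h)
  · exact Or.inr hc

/-- **The hyperbola pair is not connected by fibred + Newton–Leibniz moves** (integrand-`1`
counterpart of `StuffleInKZ.Negative.swapWitness_not_mem_closure_fibred_nl`, by the window invariant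
instead of the marginal shadow). [cite: KontsevichZagier2001, §1.2] -/
theorem hyp_not_mem_closure_fibred_nl :
    KZ.of hypRep - KZ.of hypShiftRep ∉ AddSubgroup.closure (KZ.fibredGenerators ∪ KZ.newtonLeibnizRel) :=
  fun h => not_winSemialgebraic_hyp (winSemialgebraic_of_mem_fixing (closure_fibred_nl_le_closure_fixing h))

/-- STRENGTHENING in tree vocabulary: equal-area integrand-`1` planar pairs are connected inside
`closure (KZ.fibredGenerators ∪ KZ.newtonLeibnizRel)`.  Refuter-posited, for the load-bearing
analysis. -/
def FibredNLTransitiveOnAreas : Prop :=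
  ∀ (r r' : KZ.IntegralRep 2), (∀ p ∈ r.domain, r.integrand p = 1) →
    (∀ p ∈ r'.domain, r'.integrand p = 1) → r.value = r'.value →
    KZ.of r - KZ.of r' ∈ AddSubgroup.closure (KZ.fibredGenerators ∪ KZ.newtonLeibnizRel)

/-- **The fibred + Newton–Leibniz sub-calculus does not prove the crux.** [cite: KontsevichZagier2001, §1.2] -/
theorem not_fibredNLTransitiveOnAreas : ¬ FibredNLTransitiveOnAreas := fun h =>
  hyp_not_mem_closure_fibred_nl (h hypRep hypShiftRep (fun _ _ => rfl) (fun _ _ => rfl) value_hypRep_eq)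

/-- … although the vertical translate IS fibred-equivalent to `R` (one `fibredChangeOfVariablesRel`
instance). [cite: KontsevichZagier2001, §1.2 rule (2)] -/
theorem of_hypRep_sub_of_hypUpRep_mem_fibred :
    KZ.of hypRep - KZ.of hypUpRep ∈ KZ.fibredChangeOfVariablesRel := by
  refine ⟨1, hypRep, hypUpRep, fun p => p + (![0, 5] : Fin 2 → ℝ),
    fun _ => ContinuousLinearMap.id ℝ (Fin 2 → ℝ), ?_, ?_, ?_, ?_, ?_, ?_, rfl⟩
  · have := isSemialgebraicMapOn_aeval (k := ℚ) (R := ℝ) hypRep.isSemialgebraic_domain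
      (![X 0, X 1 + C 5] : Fin 2 → MvPolynomial (Fin 2) ℚ)
    convert this using 2 with x
    funext j
    fin_cases j <;> simp
  · intro x _
    exact (hasFDerivWithinAt_id x _).add_const _
  · intro x _ y _ hxy
    exact add_right_cancel hxy
  · rw [hypUpRep_domain, hypRep_domain, hypUpSet_eq_image]
  · intro x _
    simp [hypRep, hypUpRep, ContinuousLinearMap.det]
  · intro x _
    simp

/-- So `R` and `R + (0,5)` are `KZ.FibredEquivalent`, `R` and `R + (3,0)` are not even
fibred+NL-equivalent. [cite: KontsevichZagier2001, §1.2] -/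
theorem fibredEquivalent_hypRep_hypUpRep : KZ.FibredEquivalent hypRep hypUpRep :=
  KZ.mem_fibredRelations_of_mem_fibredChangeOfVariablesRel of_hypRep_sub_of_hypUpRep_mem_fibred


/-! ## §2 The marginal shadow is blind on the pair

### Null regions and null differences inside `closure domainAddRel` -/

/-- A null region is in the closure of rule 1a alone (`[N] − [N] − [N] ∈ domainAddRel` with
`N = N ∪ N`, overlap `N` null). [cite: KontsevichZagier2001, §1.2 rule (1)] -/
theorem of_mem_closure_domainAddRel_of_volume_eq_zero {n : ℕ} (r : KZ.IntegralRep n)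
    (h : volume r.domain = 0) : KZ.of r ∈ AddSubgroup.closure KZ.domainAddRel := by
  have hmem : KZ.of r - KZ.of r - KZ.of r ∈ KZ.domainAddRel :=
    ⟨n, r, r, r, (union_self _).symm, by rwa [inter_self], fun _ _ => rfl, fun _ _ => rfl, rfl⟩
  have heq : KZ.of r - KZ.of r - KZ.of r = -KZ.of r := by abel
  have := AddSubgroup.subset_closure hmem
  rw [heq] at this
  simpa using AddSubgroup.neg_mem _ this

/-- `closure domainAddRel ≤ covFreeRelations`. [folklore] -/
theorem closure_domainAddRel_le_covFree :
    AddSubgroup.closure KZ.domainAddRel ≤ covFreeRelations :=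
  AddSubgroup.closure_mono fun _ hc => Or.inl (Or.inl hc)

/-- **Null differences inside rule 1a**: two integrand-`1` planar representations whose domains
differ by null sets are congruent modulo `closure domainAddRel` (the 1a-only version of
`equivalent_of_null_diff`). [cite: KontsevichZagier2001, §1.2 rule (1)] -/
theorem sub_mem_closure_domainAddRel_of_null_diff (r r' : KZ.IntegralRep 2)
    (hr : ∀ p ∈ r.domain, r.integrand p = 1) (hr' : ∀ p ∈ r'.domain, r'.integrand p = 1)
    (h₁ : volume (r.domain \ r'.domain) = 0) (h₂ : volume (r'.domain \ r.domain) = 0) :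
    KZ.of r - KZ.of r' ∈ AddSubgroup.closure KZ.domainAddRel := by
  have hσ := r.isSemialgebraic_domain
  have hσ' := r'.isSemialgebraic_domain
  have hfin := volume_lt_top_of_integrand_one r hr
  let i : KZ.IntegralRep 2 := constOneRep (r.domain ∩ r'.domain) (hσ.inter hσ')
    (lt_top_iff_ne_top.mp ((measure_mono inter_subset_left).trans_lt hfin))
  let d : KZ.IntegralRep 2 := constOneRep (r.domain \ r'.domain) (hσ.diff hσ')
    (by rw [h₁]; exact ENNReal.zero_ne_top)
  let d' : KZ.IntegralRep 2 := constOneRep (r'.domain \ r.domain) (hσ'.diff hσ)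
    (by rw [h₂]; exact ENNReal.zero_ne_top)
  have ha : KZ.of r - KZ.of i - KZ.of d ∈ AddSubgroup.closure KZ.domainAddRel := by
    refine AddSubgroup.subset_closure ⟨2, r, i, d, ?_, ?_, ?_, ?_, rfl⟩
    · simp [i, d]
    · simp [i, d]
      rw [show r.domain ∩ r'.domain ∩ (r.domain \ r'.domain) = ∅ by
        ext x; simp only [mem_inter_iff, Set.mem_sdiff, mem_empty_iff_false, iff_false]; tauto]
      exact measure_empty
    · intro x hx; exact hr x hx.1
    · intro x hx; exact hr x hx.1
  have ha' : KZ.of r' - KZ.of i - KZ.of d' ∈ AddSubgroup.closure KZ.domainAddRel := by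
    refine AddSubgroup.subset_closure ⟨2, r', i, d', ?_, ?_, ?_, ?_, rfl⟩
    · simp only [i, d', constOneRep_domain]
      rw [inter_comm, inter_union_sdiff]
    · simp only [i, d', constOneRep_domain]
      rw [show r.domain ∩ r'.domain ∩ (r'.domain \ r.domain) = ∅ by
        ext x; simp only [mem_inter_iff, Set.mem_sdiff, mem_empty_iff_false, iff_false]; tauto]
      exact measure_empty
    · intro x hx; exact hr' x hx.2
    · intro x hx; exact hr' x hx.1
  have hd : KZ.of d ∈ AddSubgroup.closure KZ.domainAddRel :=
    of_mem_closure_domainAddRel_of_volume_eq_zero d h₁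
  have hd' : KZ.of d' ∈ AddSubgroup.closure KZ.domainAddRel :=
    of_mem_closure_domainAddRel_of_volume_eq_zero d' h₂
  have : KZ.of r - KZ.of r' =
      (KZ.of r - KZ.of i - KZ.of d) - (KZ.of r' - KZ.of i - KZ.of d') + KZ.of d - KZ.of d' := by
    abel
  rw [this]
  exact AddSubgroup.sub_mem _ (AddSubgroup.add_mem _ (AddSubgroup.sub_mem _ ha ha') hd) hd'

/-! ## `R` and `R + (3,0)` are CoV-free congruent to their dimension-1 shadows -/

/-- **`[R] − [(1,2), 1/x] ∈ covFreeRelations`**: rule 1a against the null arcs `{y = 0}`,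
`{xy = 1}` and ONE Newton–Leibniz move (`KZ.exists_underGraph`). [cite: KontsevichZagier2001, §1.2] -/
theorem of_hypRep_sub_of_invShiftRep_mem_covFree :
    KZ.of hypRep - KZ.of (invShiftRep 0) ∈ covFreeRelations := by
  have h0 : ∀ x ∈ (invShiftRep 0).domain, 0 ≤ (invShiftRep 0).integrand x := by
    intro x hx
    have : (1:ℝ) + (0:ℚ) < x 0 := hx.1
    simp only [invShiftRep_integrand, Rat.cast_zero, sub_zero, inv_nonneg]
    push_cast at this
    linarith
  obtain ⟨G, hGd, hGi, hG⟩ := KZ.exists_underGraph (invShiftRep 0) h0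
  have hmemG : ∀ p : Fin 2 → ℝ, p ∈ G.domain ↔ p 0 ∈ Ioo (1:ℝ) 2 ∧ 0 ≤ p 1 ∧ p 1 ≤ (p 0)⁻¹ := by
    intro p
    rw [hGd]
    show (Fin.init p ∈ {x : Fin 1 → ℝ | x 0 ∈ Ioo ((1:ℝ) + (0:ℚ)) (2 + (0:ℚ))} ∧
      (0:ℝ) ≤ p (Fin.last 1) ∧ p (Fin.last 1) ≤ (Fin.init p 0 - ((0:ℚ) : ℝ))⁻¹) ↔ _
    simp only [mem_setOf_eq, Rat.cast_zero, add_zero, sub_zero]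
    rfl
  have hnull1 : volume {p : Fin 2 → ℝ | p 1 = 0} = 0 := by
    have := MvPolynomial.volume_zeroSet_eq_zero 2 (X 1) (X_ne_zero 1)
    simpa using this
  have hnull2 : volume {p : Fin 2 → ℝ | p 0 * p 1 = 1} = 0 := by
    have hne : (X 0 * X 1 - 1 : MvPolynomial (Fin 2) ℝ) ≠ 0 := by
      intro h
      have := congrArg (MvPolynomial.eval (fun _ : Fin 2 => (0:ℝ))) h
      simp at this
    have := MvPolynomial.volume_zeroSet_eq_zero 2 (X 0 * X 1 - 1) hne
    simpa [sub_eq_zero] using this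
  have hRG : KZ.of hypRep - KZ.of G ∈ AddSubgroup.closure KZ.domainAddRel := by
    refine sub_mem_closure_domainAddRel_of_null_diff hypRep G (fun _ _ => rfl)
      (fun p _ => by rw [hGi]) ?_ ?_
    · rw [show hypRep.domain \ G.domain = ∅ by
        ext p
        simp only [mem_empty_iff_false, iff_false]
        intro hp
        rw [Set.mem_sdiff, hmemG, hypRep_domain] at hp
        have hp1 : 1 < p 0 ∧ p 0 < 2 ∧ 0 < p 1 ∧ p 0 * p 1 < 1 := hp.1
        obtain ⟨h1, h2, h3, h4⟩ := hp1
        have h0 : 0 < p 0 := by linarith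
        refine hp.2 ⟨⟨h1, h2⟩, h3.le, ?_⟩
        rw [← one_div, le_div_iff₀ h0]
        linarith [mul_comm (p 0) (p 1)]]
      exact measure_empty
    · refine measure_mono_null (fun p hp => ?_) (measure_union_null hnull1 hnull2)
      rw [Set.mem_sdiff, hmemG, hypRep_domain] at hp
      obtain ⟨⟨⟨h1, h2⟩, h3, h4⟩, hn⟩ := hp
      replace hn : ¬ (1 < p 0 ∧ p 0 < 2 ∧ 0 < p 1 ∧ p 0 * p 1 < 1) := hn
      have h0 : 0 < p 0 := by linarith
      simp only [mem_union, mem_setOf_eq]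
      by_contra hcon
      simp only [not_or] at hcon
      apply hn
      refine ⟨h1, h2, lt_of_le_of_ne h3 (Ne.symm hcon.1), ?_⟩
      rw [← one_div, le_div_iff₀ h0] at h4
      exact lt_of_le_of_ne (by linarith [mul_comm (p 0) (p 1)]) hcon.2
  have hGr : KZ.of G - KZ.of (invShiftRep 0) ∈ covFreeRelations :=
    newtonLeibnizRel_subset_covFreeRelations hG
  have : KZ.of hypRep - KZ.of (invShiftRep 0) =
      (KZ.of hypRep - KZ.of G) + (KZ.of G - KZ.of (invShiftRep 0)) := by abel
  rw [this]
  exact AddSubgroup.add_mem _ (closure_domainAddRel_le_covFree hRG) hGr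

/-- **`[R + (3,0)] − [(4,5), 1/(x−3)] ∈ covFreeRelations`** likewise. [cite: KontsevichZagier2001, §1.2] -/
theorem of_hypShiftRep_sub_of_invShiftRep_mem_covFree :
    KZ.of hypShiftRep - KZ.of (invShiftRep 3) ∈ covFreeRelations := by
  have h3 : ∀ x ∈ (invShiftRep 3).domain, 0 ≤ (invShiftRep 3).integrand x := by
    intro x hx
    have : (1:ℝ) + (3:ℚ) < x 0 := hx.1
    simp only [invShiftRep_integrand, Rat.cast_ofNat, inv_nonneg]
    push_cast at this
    linarith
  obtain ⟨G', hGd', hGi', hG'⟩ := KZ.exists_underGraph (invShiftRep 3) h3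
  have hmemG' : ∀ p : Fin 2 → ℝ, p ∈ G'.domain ↔ p 0 ∈ Ioo (4:ℝ) 5 ∧ 0 ≤ p 1 ∧ p 1 ≤ (p 0 - 3)⁻¹ := by
    intro p
    rw [hGd']
    show (Fin.init p ∈ {x : Fin 1 → ℝ | x 0 ∈ Ioo ((1:ℝ) + (3:ℚ)) (2 + (3:ℚ))} ∧
      (0:ℝ) ≤ p (Fin.last 1) ∧ p (Fin.last 1) ≤ (Fin.init p 0 - ((3:ℚ) : ℝ))⁻¹) ↔ _
    simp only [mem_setOf_eq, Rat.cast_ofNat]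
    norm_num
    rfl
  have hnull1 : volume {p : Fin 2 → ℝ | p 1 = 0} = 0 := by
    have := MvPolynomial.volume_zeroSet_eq_zero 2 (X 1) (X_ne_zero 1)
    simpa using this
  have hnull3 : volume {p : Fin 2 → ℝ | (p 0 - 3) * p 1 = 1} = 0 := by
    have hne : ((X 0 - 3) * X 1 - 1 : MvPolynomial (Fin 2) ℝ) ≠ 0 := by
      intro h
      have := congrArg (MvPolynomial.eval (fun _ : Fin 2 => (0:ℝ))) h
      simp at this
    have := MvPolynomial.volume_zeroSet_eq_zero 2 ((X 0 - 3) * X 1 - 1) hne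
    simpa [sub_eq_zero] using this
  have hRG' : KZ.of hypShiftRep - KZ.of G' ∈ AddSubgroup.closure KZ.domainAddRel := by
    refine sub_mem_closure_domainAddRel_of_null_diff hypShiftRep G' (fun _ _ => rfl)
      (fun p _ => by rw [hGi']) ?_ ?_
    · rw [show hypShiftRep.domain \ G'.domain = ∅ by
        ext p
        simp only [mem_empty_iff_false, iff_false]
        intro hp
        rw [Set.mem_sdiff, hmemG', hypShiftRep_domain] at hp
        have hp1 : 4 < p 0 ∧ p 0 < 5 ∧ 0 < p 1 ∧ (p 0 - 3) * p 1 < 1 := hp.1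
        obtain ⟨h1, h2, h3, h4⟩ := hp1
        have h0 : 0 < p 0 - 3 := by linarith
        refine hp.2 ⟨⟨h1, h2⟩, h3.le, ?_⟩
        rw [← one_div, le_div_iff₀ h0]
        linarith [mul_comm (p 0 - 3) (p 1)]]
      exact measure_empty
    · refine measure_mono_null (fun p hp => ?_) (measure_union_null hnull1 hnull3)
      rw [Set.mem_sdiff, hmemG', hypShiftRep_domain] at hp
      obtain ⟨⟨⟨h1, h2⟩, h3', h4⟩, hn⟩ := hp
      replace hn : ¬ (4 < p 0 ∧ p 0 < 5 ∧ 0 < p 1 ∧ (p 0 - 3) * p 1 < 1) := hn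
      have h0 : 0 < p 0 - 3 := by linarith
      simp only [mem_union, mem_setOf_eq]
      by_contra hcon
      simp only [not_or] at hcon
      apply hn
      refine ⟨h1, h2, lt_of_le_of_ne h3' (Ne.symm hcon.1), ?_⟩
      rw [← one_div, le_div_iff₀ h0] at h4
      exact lt_of_le_of_ne (by linarith [mul_comm (p 0 - 3) (p 1)]) hcon.2
  have hGr' : KZ.of G' - KZ.of (invShiftRep 3) ∈ covFreeRelations :=
    newtonLeibnizRel_subset_covFreeRelations hG'
  have : KZ.of hypShiftRep - KZ.of (invShiftRep 3) =
      (KZ.of hypShiftRep - KZ.of G') + (KZ.of G' - KZ.of (invShiftRep 3)) := by abel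
  rw [this]
  exact AddSubgroup.add_mem _ (closure_domainAddRel_le_covFree hRG') hGr'

/-! ## The marginal shadow is blind on the pair -/


/-- More generally, EVERY planar representation one Newton–Leibniz move above a dimension-`1`
representation (e.g. the under-graph regions of `KZ.exists_underGraph`) has an algebraic shadow. [cite: KontsevichZagier2001, §1.2] -/
theorem hasAlgShadow_of_sub_mem_newtonLeibnizRel {G : KZ.IntegralRep 2} {s : KZ.IntegralRep 1}
    (h : KZ.of G - KZ.of s ∈ KZ.newtonLeibnizRel) : HasAlgShadow (KZ.of G) := by
  have h1 : HasAlgShadow (KZ.of G - KZ.of s) :=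
    covFreeRelations_le_algShadow (newtonLeibnizRel_subset_covFreeRelations h)
  have := h1.add (hasAlgShadow_of_dim_one s)
  rwa [sub_add_cancel] at this

/-- **`[R]` has an algebraic shadow** (that of `[(1,2), 1/x]`: the marginal of `R` is the fibre
length `1/s` on `(1,2)`). [cite: KontsevichZagier2001, §1.2] -/
theorem hasAlgShadow_hypRep : HasAlgShadow (KZ.of hypRep) := by
  have h1 : HasAlgShadow (KZ.of hypRep - KZ.of (invShiftRep 0)) :=
    covFreeRelations_le_algShadow of_hypRep_sub_of_invShiftRep_mem_covFree
  have h2 : HasAlgShadow (KZ.of (invShiftRep 0)) := hasAlgShadow_of_dim_one (invShiftRep 0)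
  have := h1.add h2
  rwa [sub_add_cancel] at this

/-- **`[R + (3,0)]` has an algebraic shadow** (`1/(s−3)` on `(4,5)`). [cite: KontsevichZagier2001, §1.2] -/
theorem hasAlgShadow_hypShiftRep : HasAlgShadow (KZ.of hypShiftRep) := by
  have h1 : HasAlgShadow (KZ.of hypShiftRep - KZ.of (invShiftRep 3)) :=
    covFreeRelations_le_algShadow of_hypShiftRep_sub_of_invShiftRep_mem_covFree
  have h2 : HasAlgShadow (KZ.of (invShiftRep 3)) := hasAlgShadow_of_dim_one (invShiftRep 3)
  have := h1.add h2
  rwa [sub_add_cancel] at this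

/-- **The marginal-shadow invariant does not separate the §3c pair**: `[R] − [R + (3,0)] ∈ algShadow`
although it lies outside `covFreeRelations` (`not_withoutRule2`) and even outside the fibred + NL
sub-calculus (Negative/HorizontalMove).  On areas the shadow is always algebraic; only its primitive
(the window function `log e`) carries the transcendence. [cite: KontsevichZagier2001, §1.2] -/
theorem hasAlgShadow_hyp_pair : HasAlgShadow (KZ.of hypRep - KZ.of hypShiftRep) := by
  have := hasAlgShadow_hypRep.add hasAlgShadow_hypShiftRep.neg
  rwa [← sub_eq_add_neg] at this

/-- Restated as membership in the subgroup `algShadow`. [cite: KontsevichZagier2001, §1.2] -/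
theorem hyp_pair_mem_algShadow : KZ.of hypRep - KZ.of hypShiftRep ∈ algShadow :=
  (mem_algShadow).mpr hasAlgShadow_hyp_pair

/-- **Complementarity in one statement**: the pair's difference is INSIDE `algShadow` and OUTSIDE
the window class `WinSemialgebraic`; consequently it lies outside `covFreeRelations` and outside the
fibred + Newton–Leibniz sub-calculus, certified by the window invariant and invisible to the
marginal shadow. [cite: KontsevichZagier2001, §1.2] -/
theorem shadow_blind_window_sees :
    HasAlgShadow (KZ.of hypRep - KZ.of hypShiftRep) ∧
      ¬ WinSemialgebraic (KZ.of hypRep - KZ.of hypShiftRep) ∧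
      KZ.of hypRep - KZ.of hypShiftRep ∉ covFreeRelations ∧
      KZ.of hypRep - KZ.of hypShiftRep ∉
        AddSubgroup.closure (KZ.fibredGenerators ∪ KZ.newtonLeibnizRel) := by
  refine ⟨hasAlgShadow_hyp_pair, not_winSemialgebraic_hyp, fun h => ?_, hyp_not_mem_closure_fibred_nl⟩
  refine not_winSemialgebraic_hyp (winSemialgebraic_of_mem_fixing ((AddSubgroup.closure_mono ?_) h))
  rintro c ((hc | hc) | hc)
  · exact Or.inl (Or.inl (Or.inl hc))
  · exact Or.inl (Or.inl (Or.inr hc))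
  · exact Or.inr hc

end Summit.KontsevichZagierPeriods.PlanarAreas.Negative

end
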